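import Mathlib.Topology.Baire.Lemmas
import Mathlib.Topology.Baire.CompleteMetrizable
import Literature.Geometry.Lorentzian.FinalState
import Literature.Geometry.Lorentzian.Genericity
import HarnessLib

/-!
# Route PhotonSphereChannels · crux `TameCensorship` (stmt-FinalStateConjecture-17431) · line `Sketch`, skeleton v9 ·
# stub `stub_residualOfRobust`: ROBUST (open dense) ⇒ RESIDUAL escapability (def-free, abstract in Q)

Helper file (`--supports stmt-FinalStateConjecture-17431`) of line `Sketch` (lead c4, 2026-08-17, wave 2): one brick of the
RESIDUAL legend. Residual escapability of a property `Q` of initial data at a datum `d`: every compactly supported smooth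
admissible probe through `d` enriches, along an injective linear map of parameter spaces, to one along all of whose further
enrichments a RESIDUAL (comeagre, `residual (EuclideanSpace ℝ (Fin p))`, Mathlib `Topology/GDelta/Basic`) set of radial
directions has `Q` for all small non-zero parameters — the v9 weakening of the open-dense ("robust") legend of v4–v8.
What: the comparison ROBUST => RESIDUAL of the two legends. If every probe through `d` enriches to one along all of
whose further enrichments an OPEN DENSE set of radial directions is good for `Q`, then the same holds with "open dense"
replaced by "residual". Why: item stmt-10131 `CensorshipRobust` is stated with open dense direction sets and enters the
residual composition of the skeleton through this lemma. Proof: keep the enrichment `(n, G₁, L)`, and for every further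
enrichment `(p, G₂, L')` keep the same direction set `U` and the same radii; an open dense set is residual, Mathlib
`residual_of_dense_open : IsOpen s → Dense s → s ∈ residual X` (`Mathlib/Topology/GDelta/Basic.lean`). Pure bookkeeping;
no choice, no topology beyond that one lemma. [folklore]
-/

set_option linter.dupNamespace false

open Literature.Geometry.Lorentzian
open scoped Manifold ContDiff Topology
open Filter Set Function

noncomputable section

namespace Summit.FinalStateConjecture.FinalStateConjecture.Theorems.PhotonSphereChannels.TameCensorshipUnwind

/-- **Stub `stub_residualOfRobust` of line `Sketch` (skeleton v9) for the crux `PhotonSphereChannels.TameCensorship`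
(stmt-FinalStateConjecture-17431): ROBUST escapability implies RESIDUAL escapability.** For an arbitrary datum `d` and a
property `Q` of initial data: if every compactly supported smooth admissible probe through `d` enriches (along an
injective linear map of parameter spaces) to one along all of whose further enrichments an OPEN DENSE set of radial
directions has `Q` for all small non-zero parameters, then the same holds with a RESIDUAL (comeagre) set of directions,
`U ∈ residual (EuclideanSpace ℝ (Fin p))`. Proof idea: take the same enrichment, the same set of directions and the same
radii; an open dense set is residual (`residual_of_dense_open`). Stated DEF-FREE (the registered stub signature inlines
the probe legend) so that it does not depend on the skeleton's local definitions. [folklore] -/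
theorem stub_residualOfRobust :
    ∀ (X : Type) [TopologicalSpace X] [ChartedSpace E3 X] [IsManifold (𝓡 3) ∞ X] [T2Space X]
    [SecondCountableTopology X] [ConnectedSpace X] (d : InitialDataSet (𝓡 3) X) (Q : InitialDataSet (𝓡 3) X →
    Prop), (∀ (m : ℕ) (G : EuclideanSpace ℝ (Fin m) → InitialDataSet (𝓡 3) X),
    (InitialDataSet.IsSmoothDataFamily m G ∧ G 0 = d ∧ (∀ c, G c ∈ admissibleVacuumData X) ∧ ∃ K : Set X,
    IsCompact K ∧ ∀ c, ∀ x ∉ K, (G c).h.inner x = d.h.inner x ∧ (G c).k x = d.k x) → ∃ (n : ℕ) (G₁ :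
    EuclideanSpace ℝ (Fin n) → InitialDataSet (𝓡 3) X) (L : EuclideanSpace ℝ (Fin m) →ₗ[ℝ] EuclideanSpace ℝ (Fin
    n)), Function.Injective L ∧ (InitialDataSet.IsSmoothDataFamily n G₁ ∧ G₁ 0 = d ∧ (∀ c, G₁ c ∈
    admissibleVacuumData X) ∧ ∃ K : Set X, IsCompact K ∧ ∀ c, ∀ x ∉ K, (G₁ c).h.inner x = d.h.inner x ∧ (G₁ c).k
    x = d.k x) ∧ (∀ c, G₁ (L c) = G c) ∧ ∀ (p : ℕ) (G₂ : EuclideanSpace ℝ (Fin p) → InitialDataSet (𝓡 3) X) (L'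
    : EuclideanSpace ℝ (Fin n) →ₗ[ℝ] EuclideanSpace ℝ (Fin p)), Function.Injective L' →
    (InitialDataSet.IsSmoothDataFamily p G₂ ∧ G₂ 0 = d ∧ (∀ c, G₂ c ∈ admissibleVacuumData X) ∧ ∃ K : Set X,
    IsCompact K ∧ ∀ c, ∀ x ∉ K, (G₂ c).h.inner x = d.h.inner x ∧ (G₂ c).k x = d.k x) → (∀ c, G₂ (L' c) = G₁ c) →
    ∃ U : Set (EuclideanSpace ℝ (Fin p)), IsOpen U ∧ Dense U ∧ ∀ v ∈ U, ∃ δ : ℝ, 0 < δ ∧ ∀ t : ℝ, t ≠ 0 → |t| <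
    δ → Q (G₂ (t • v))) → ∀ (m : ℕ) (G : EuclideanSpace ℝ (Fin m) → InitialDataSet (𝓡 3) X),
    (InitialDataSet.IsSmoothDataFamily m G ∧ G 0 = d ∧ (∀ c, G c ∈ admissibleVacuumData X) ∧ ∃ K : Set X,
    IsCompact K ∧ ∀ c, ∀ x ∉ K, (G c).h.inner x = d.h.inner x ∧ (G c).k x = d.k x) → ∃ (n : ℕ) (G₁ :
    EuclideanSpace ℝ (Fin n) → InitialDataSet (𝓡 3) X) (L : EuclideanSpace ℝ (Fin m) →ₗ[ℝ] EuclideanSpace ℝ (Fin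
    n)), Function.Injective L ∧ (InitialDataSet.IsSmoothDataFamily n G₁ ∧ G₁ 0 = d ∧ (∀ c, G₁ c ∈
    admissibleVacuumData X) ∧ ∃ K : Set X, IsCompact K ∧ ∀ c, ∀ x ∉ K, (G₁ c).h.inner x = d.h.inner x ∧ (G₁ c).k
    x = d.k x) ∧ (∀ c, G₁ (L c) = G c) ∧ ∀ (p : ℕ) (G₂ : EuclideanSpace ℝ (Fin p) → InitialDataSet (𝓡 3) X) (L'
    : EuclideanSpace ℝ (Fin n) →ₗ[ℝ] EuclideanSpace ℝ (Fin p)), Function.Injective L' →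
    (InitialDataSet.IsSmoothDataFamily p G₂ ∧ G₂ 0 = d ∧ (∀ c, G₂ c ∈ admissibleVacuumData X) ∧ ∃ K : Set X,
    IsCompact K ∧ ∀ c, ∀ x ∉ K, (G₂ c).h.inner x = d.h.inner x ∧ (G₂ c).k x = d.k x) → (∀ c, G₂ (L' c) = G₁ c) →
    ∃ U : Set (EuclideanSpace ℝ (Fin p)), U ∈ residual (EuclideanSpace ℝ (Fin p)) ∧ ∀ v ∈ U, ∃ δ : ℝ, 0 < δ ∧ ∀
    t : ℝ, t ≠ 0 → |t| < δ → Q (G₂ (t • v)) := by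
  intro X _ _ _ _ _ _ d Q h m G hG
  obtain ⟨n, G₁, L, hL, hG₁, hLG, hR⟩ := h m G hG
  refine ⟨n, G₁, L, hL, hG₁, hLG, fun p G₂ L' hL' hG₂ hL'G => ?_⟩
  obtain ⟨U, hUo, hUd, hU⟩ := hR p G₂ L' hL' hG₂ hL'G
  exact ⟨U, residual_of_dense_open hUo hUd, hU⟩

end Summit.FinalStateConjecture.FinalStateConjecture.Theorems.PhotonSphereChannels.TameCensorshipUnwind

end
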